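import Mathlib
import Summits.QuantumFields.BalabanUV.Beta.EriceRemainderEnclosureHistoryAutonomyComparisonAgeCompositionStaticChainResolvent
import Summits.QuantumFields.BalabanUV.Beta.EriceRemainderEnclosureHistoryAutonomyComparisonAgeCompositionStaticChainStepAll

/-!
# EriceRemainderEnclosureHistoryAutonomyComparisonAgeCompositionStaticChainStageStep — (E80a) ONE STAGE OF THE OBSERVER INDUCTION: the step inequality
# (◆) with the empty older system admitted, Schur bordering of exact levels and exact responses when an age is processed, and the scalar propagation of
# the observer bound `N_z ≤ (1 + 2κΨ_zz)(1 − Ω_z)` to the enlarged system — the parts (E80b) `…StaticChainClosure` assembles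

Cell `pub-balaban`, β-function sub-cell, BINDER row D4 «RemainderConst leaves for Bałaban's split» (`HOME/BINDER-OWNERS.md`; owner lineage `b2b-balaban-beta-an4`;
this file by co-owner #2 lineage `b2b-balaban-beta-d4-p2`, generation 71), β-FLOW TEAM duty (1), FREEZE (0) honoured (def-free; imports (E78b) `…StaticChainResolvent` (hence (E78a) `…StaticChainCertificate`) and (E79zi) `…StaticChainStepAll`; nothing restated).

HONEST FRAMING (page 1, verbatim and binding).  *"Discharging BetaPertH makes Bałaban's UV stability UNCONDITIONAL — a real constructive-QFT result; it is
NOT the continuum limit and NOT the Clay problem."*  THIS FILE DISCHARGES NOTHING OF THE KIND.  Finite non-negative linear algebra and finite sums — hypotheses of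
a census, not facts; the age profile of Bałaban's (1.22) limit functional is NOT PRINTED ([I] p. 298; GAPS G-t4-U2-1∕-2) and NOT asserted.  Row D4 class
UNCHANGED (critical-path width 0; instance 0∕1; D4 DISCHARGE NO DATE).  HONEST DEPENDENCY: continuum YM on T⁴ ⇐ BetaPertH ∧ nine spine estimates (0/9 proved);
BetaPertH ⇐ (D1) ∧ (D4) ∧ CAP+tail; G-an2-4 gates asym, D1 and NE2/3/4.

THE POINT (census sense (α); route (N′) of READMEs `g67/e76`–`g70/e79`; this station `HOME/b2b-balaban-beta-d4-p2/g71/e80/README.md`).  The observer induction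
((E78a) §3, (E78) README §4) processes the ages of a LEVEL-COUPLED configuration oldest first and carries, for every later scale, the bound `N ≤ (1 +
2κΨ)(1 − Ω)` on the chain's numerator by the RETURN AMPLIFICATION `Ψ` of that scale's reads through the processed system and the WINDOW MASS `Ω`.  One stage
needs: (§1) the step inequality (◆) — (E79zi) `step_lattice_all` proved it for every pair of scales above a NON-EMPTY processed system; **`step_lattice`**
removes `0 < n` (the first age is processed above the empty system) by reading the empty system as ONE PHANTOM ELDER OF LOAD ZERO at age `y+1`, an
admissible instance of the same theorem; (§2) the scalar propagation **`observer_propagate`** = (E78a) `observer_step` + the identification of its right-hand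
side with the new target through the rank-one update `Ψ' = Ψ_zz + (2uΨ_yz + 2uσ)(φ + Ψ_zy)∕D` and `Ω' = Ω_z + u∕q`, the transport of the numerator
(`numerator_succ`: `N'(1−ρ) = N − (1−θ)ρ` in the two-index bookkeeping of (E72a)) and the sign of the carried ratios; (§3) the EXACT LEVELS and EXACT
RESPONSES of the enlarged system, built from those of the processed system by Schur bordering ((E78b) `bordered_levels`, `bordered_response`,
`functional_bordered`) once the pivot `D = 1 − G_{jj} − 2x_jΨ_yy` is positive: **`exact_levels_succ`**, **`response_succ`** (with the rank-one update of EVERY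
row functional, which is what identifies `Ψ'`).  So the induction never needs a matrix inverse: existence of exact levels∕responses at every stage is
constructive, by bordering.  NOT CLAIMED here: the induction itself ((E80b)); anything about Bałaban's flow; anything nonlinear; anything printed.

WHAT IS PROVED ([folklore]; 0 `def`, 0 sorry).  §1 **`step_lattice`**.  §2 `self_read_ge_half`, **`observer_propagate`**, `numerator_succ`, `carried_nonneg_succ`.
§3 `lc_array_nonneg`, **`exact_levels_succ`**, **`response_succ`**.
-/
noncomputable section
open Finset

namespace Summit.QuantumFields.BalabanUV.Beta.EriceRemainderEnclosureHistoryAutonomyComparisonAgeCompositionStaticChainStageStep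

open Summit.QuantumFields.BalabanUV.Beta.EriceRemainderEnclosureHistoryAutonomyComparisonAgeCompositionStaticChainCertificate
open Summit.QuantumFields.BalabanUV.Beta.EriceRemainderEnclosureHistoryAutonomyComparisonAgeCompositionStaticChainResolvent
open Summit.QuantumFields.BalabanUV.Beta.EriceRemainderEnclosureHistoryAutonomyComparisonAgeCompositionStaticChainStepAll

/-! ## §1 The step inequality (◆) with an empty older system allowed -/

/-- **(◆) FOR EVERY PAIR OF SCALES, THE OLDER SYSTEM POSSIBLY EMPTY.**  (E79zi) `step_lattice_all` with its hypothesis `0 < n` removed: for `n = 0`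
(no processed age yet — the first step of the induction) the statement is the instance `n = 1` with ONE PHANTOM ELDER at age `y + 1` carrying load `0`
(its array vanishes, its levels are `1`, its responses are the bare reads, every amplification and the window mass are `0`). [folklore] -/
theorem step_lattice {n y z : ℕ} {k : ℕ → ℕ} {x a cy cz Sy Sz Ry Rz : ℕ → ℝ} {θ xy Ψyy Ψyz Ψzy Ψzz Ωz σ φ s : ℝ}
    (hz : 1 ≤ z) (hzy : z + 1 ≤ y)
    (hk : ∀ l, l < n → y + 1 ≤ k l) (hx : ∀ l, l < n → 0 ≤ x l)
    (hSy : ∀ l, l < n → Sy l = ∑ m ∈ range y, Real.sqrt ((k l : ℝ) / ((k l : ℝ) + m + 1)))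
    (hSz : ∀ l, l < n → Sz l = ∑ m ∈ range z, Real.sqrt ((k l : ℝ) / ((k l : ℝ) + m + 1)))
    (hRy : ∀ l, l < n → Ry l = ∑ m ∈ range (k l), Real.sqrt ((y : ℝ) / ((y : ℝ) + m + 1)))
    (hRz : ∀ l, l < n → Rz l = ∑ m ∈ range (k l), Real.sqrt ((z : ℝ) / ((z : ℝ) + m + 1)))
    (ha0 : ∀ i, i < n → 0 < a i)
    (ha : ∀ i, i < n → a i = 1 + ∑ l ∈ range n,
      (2 * x l * (∑ m ∈ range (k i), Real.sqrt ((k l : ℝ) / ((k l : ℝ) + m + 1))) / k l) * a l)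
    (hcy : ∀ i, i < n → cy i = Ry i / (y : ℝ) + ∑ l ∈ range n,
      (2 * x l * (∑ m ∈ range (k i), Real.sqrt ((k l : ℝ) / ((k l : ℝ) + m + 1))) / k l) * cy l)
    (hcz : ∀ i, i < n → cz i = Rz i / (z : ℝ) + ∑ l ∈ range n,
      (2 * x l * (∑ m ∈ range (k i), Real.sqrt ((k l : ℝ) / ((k l : ℝ) + m + 1))) / k l) * cz l)
    (hΨyy : Ψyy = ∑ l ∈ range n, (2 * x l * Sy l / k l) * cy l) (hΨyz : Ψyz = ∑ l ∈ range n, (2 * x l * Sz l / k l) * cy l)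
    (hΨzy : Ψzy = ∑ l ∈ range n, (2 * x l * Sy l / k l) * cz l) (hΨzz : Ψzz = ∑ l ∈ range n, (2 * x l * Sz l / k l) * cz l)
    (hΩz : Ωz = ∑ l ∈ range n, x l * (z : ℝ) / k l)
    (hσ : σ = (∑ m ∈ range z, Real.sqrt ((y : ℝ) / ((y : ℝ) + m + 1))) / (y : ℝ))
    (hφ : φ = (∑ m ∈ range y, Real.sqrt ((z : ℝ) / ((z : ℝ) + m + 1))) / (z : ℝ))
    (hs : s = (∑ m ∈ range y, Real.sqrt ((y : ℝ) / ((y : ℝ) + m + 1))) / (y : ℝ))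
    (hθ : θ ≤ 1 - ((y : ℝ) / z) / ((y : ℝ) / z + 1) * Real.sqrt (((y : ℝ) / z) / ((y : ℝ) / z + 1)) * Real.exp (-(1 / (2 * ((y : ℝ) / z)))))
    (hxy : 0 ≤ xy) (hcap : 2 * xy * (s + Ψyy) < 1) :
    (1 + 2 * (31/40:ℝ) * Ψzz) * (1 - Ωz) - (1 - θ) * (xy * (1 + 2 * (31/40:ℝ) * Ψyy))
      ≤ (1 - xy * (1 + 2 * (31/40:ℝ) * Ψyy)) *
        ((1 + 2 * (31/40:ℝ) * Ψzz + 4 * (31/40:ℝ) * xy * ((σ + Ψyz) * (φ + Ψzy)) / (1 - 2 * (s + Ψyy) * xy)) * ((1 - Ωz) - xy / ((y : ℝ) / (z : ℝ)))) := by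
  rcases Nat.eq_zero_or_pos n with hn | hn
  · -- empty older system: one PHANTOM elder at age `y + 1` with load `0`
    subst hn
    simp only [range_zero, sum_empty] at hΨyy hΨyz hΨzy hΨzz hΩz
    have h := step_lattice_all (n := 1) (k := fun _ => y + 1) (x := fun _ => 0) (a := fun _ => 1)
      (cy := fun _ => (∑ m ∈ range (y + 1), Real.sqrt ((y : ℝ) / ((y : ℝ) + m + 1))) / (y : ℝ))
      (cz := fun _ => (∑ m ∈ range (y + 1), Real.sqrt ((z : ℝ) / ((z : ℝ) + m + 1))) / (z : ℝ))
      (Sy := fun _ => ∑ m ∈ range y, Real.sqrt ((((y + 1 : ℕ) : ℕ) : ℝ) / ((((y + 1 : ℕ) : ℕ) : ℝ) + m + 1)))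
      (Sz := fun _ => ∑ m ∈ range z, Real.sqrt ((((y + 1 : ℕ) : ℕ) : ℝ) / ((((y + 1 : ℕ) : ℕ) : ℝ) + m + 1)))
      (Ry := fun _ => ∑ m ∈ range (y + 1), Real.sqrt ((y : ℝ) / ((y : ℝ) + m + 1)))
      (Rz := fun _ => ∑ m ∈ range (y + 1), Real.sqrt ((z : ℝ) / ((z : ℝ) + m + 1)))
      (θ := θ) (xy := xy) (Ψyy := 0) (Ψyz := 0) (Ψzy := 0) (Ψzz := 0) (Ωz := 0) (σ := σ) (φ := φ) (s := s)
      hz hzy one_pos (fun _ _ => le_rfl) (fun _ _ => le_rfl) (fun _ _ => rfl) (fun _ _ => rfl) (fun _ _ => rfl) (fun _ _ => rfl)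
      (fun _ _ => one_pos) (fun _ _ => by simp) (fun _ _ => by simp) (fun _ _ => by simp)
      (by simp) (by simp) (by simp) (by simp) (by simp) hσ hφ hs hθ hxy (by rw [hΨyy] at hcap; simpa using hcap)
    rw [hΨyy, hΨyz, hΨzy, hΨzz, hΩz]
    exact h
  · exact step_lattice_all hz hzy hn hk hx hSy hSz hRy hRz ha0 ha hcy hcz hΨyy hΨyz hΨzy hΨzz hΩz hσ hφ hs hθ hxy hcap

/-! ## §2 Scalar and bookkeeping lemmas of the induction -/

/-- `s_y = S(y,y)∕y ≥ 1∕2` for every `y ≥ 1` (each summand `√(y∕(y+m+1)) ≥ √(1∕4)` as `y + m + 1 ≤ 4y`). [folklore] -/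
theorem self_read_ge_half {y : ℕ} (hy : 1 ≤ y) :
    1 / 2 ≤ (∑ t ∈ range y, Real.sqrt ((y : ℝ) / ((y : ℝ) + t + 1))) / (y : ℝ) := by
  have hy0 : (0 : ℝ) < y := by exact_mod_cast hy
  rw [le_div_iff₀ hy0]
  have hterm : ∀ t ∈ range y, (1 / 2 : ℝ) ≤ Real.sqrt ((y : ℝ) / ((y : ℝ) + t + 1)) := by
    intro t ht
    have ht' : (t : ℝ) + 1 ≤ y := by exact_mod_cast Nat.succ_le_of_lt (mem_range.mp ht)
    have h1 : (1 / 4 : ℝ) ≤ (y : ℝ) / ((y : ℝ) + t + 1) := by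
      rw [le_div_iff₀ (by positivity)]; linarith
    calc (1 / 2 : ℝ) = Real.sqrt (1 / 4) := by
          rw [show (1 / 4 : ℝ) = (1 / 2) ^ 2 by norm_num, Real.sqrt_sq (by norm_num)]
      _ ≤ Real.sqrt ((y : ℝ) / ((y : ℝ) + t + 1)) := Real.sqrt_le_sqrt h1
  calc 1 / 2 * (y : ℝ) = ∑ _t ∈ range y, (1 / 2 : ℝ) := by simp [mul_comm]
    _ ≤ ∑ t ∈ range y, Real.sqrt ((y : ℝ) / ((y : ℝ) + t + 1)) := sum_le_sum hterm

/-- **THE OBSERVER BOUND PROPAGATES (scalar form).**  (E78a) `observer_step` followed by the identification of its right-hand side with the new target: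
`Ψ'_zz = Ψ_zz + (2uΨ_yz + 2uσ)(φ + Ψ_zy)∕D` ((E78b) `functional_bordered`, `D = 1 − 2us − 2uΨ_yy` the Schur pivot) and `Ω'_z = Ω_z + u∕q`. [folklore] -/
theorem observer_propagate {N N' ρ θ u Ψyy Ψzz Ψyz Ψzy Ψ' Ωz Ω' σ φ s D fz gs q κ : ℝ}
    (hθ0 : 0 ≤ θ) (hN1 : 1 ≤ N) (hH : N ≤ (1 + 2 * κ * Ψzz) * (1 - Ωz))
    (hρ : ρ ≤ u * (1 + 2 * κ * Ψyy)) (hρb1 : u * (1 + 2 * κ * Ψyy) < 1)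
    (hN' : N' * (1 - ρ) = N - (1 - θ) * ρ)
    (hdia : (1 + 2 * κ * Ψzz) * (1 - Ωz) - (1 - θ) * (u * (1 + 2 * κ * Ψyy))
      ≤ (1 - u * (1 + 2 * κ * Ψyy)) *
        ((1 + 2 * κ * Ψzz + 4 * κ * u * ((σ + Ψyz) * (φ + Ψzy)) / (1 - 2 * (s + Ψyy) * u)) * ((1 - Ωz) - u / q)))
    (hΨ' : Ψ' = Ψzz + (2 * u * Ψyz + fz) * (φ + Ψzy) / D) (hfz : fz = 2 * u * σ)
    (hD : D = 1 - gs - 2 * u * Ψyy) (hgs : gs = 2 * u * s) (hΩ' : Ω' = Ωz + u / q) :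
    N' ≤ (1 + 2 * κ * Ψ') * (1 - Ω') := by
  have h := observer_step hθ0 hN1 hH hρ hρb1 hN' hdia
  have hE : (1 + 2 * κ * Ψzz + 4 * κ * u * ((σ + Ψyz) * (φ + Ψzy)) / (1 - 2 * (s + Ψyy) * u)) * ((1 - Ωz) - u / q)
      = (1 + 2 * κ * Ψ') * (1 - Ω') := by
    rw [hΨ', hΩ', hfz, hD, hgs]
    have hden : (1 - 2 * u * s - 2 * u * Ψyy) = (1 - 2 * (s + Ψyy) * u) := by ring
    rw [hden]
    ring
  rw [← hE]
  exact h

/-- **TRANSPORT OF THE NUMERATOR.**  The chain's numerator seen from a target `m`, `N_j(m) = 1 + Σ_{i<j} θ_{m,i} b_{j,i}`, obeys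
`N_{j+1}(m)·(1 − ρ_j) = N_j(m) − (1 − θ_{m,j})ρ_j` under the static chain's update of the carried ratios ((E72a) `one_add_load_succ_mul` in the
two-index bookkeeping). [folklore] -/
theorem numerator_succ {ρ : ℕ → ℝ} {θ b : ℕ → ℕ → ℝ} {j m : ℕ}
    (hnew : b (j + 1) j = ρ j / (1 - ρ j)) (hold : ∀ i, i < j → b (j + 1) i = b j i / (1 - ρ j)) (hρ1 : ρ j < 1) :
    (1 + ∑ i ∈ range (j + 1), θ m i * b (j + 1) i) * (1 - ρ j) = (1 + ∑ i ∈ range j, θ m i * b j i) - (1 - θ m j) * ρ j := by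
  have hne : (1 - ρ j) ≠ 0 := (sub_pos.mpr hρ1).ne'
  have hsum : ∑ i ∈ range j, θ m i * b (j + 1) i = (∑ i ∈ range j, θ m i * b j i) / (1 - ρ j) := by
    rw [sum_div]; exact sum_congr rfl fun i hi => by rw [hold i (mem_range.mp hi)]; ring
  rw [sum_range_succ, hnew, hsum]
  field_simp
  ring

/-- The carried ratios stay non-negative: `b_{j+1,i} ≥ 0` for `i ≤ j` from `b_{j,i} ≥ 0` and `ρ_j ∈ [0,1)`. [folklore] -/
theorem carried_nonneg_succ {ρ : ℕ → ℝ} {b : ℕ → ℕ → ℝ} {j : ℕ}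
    (hnew : b (j + 1) j = ρ j / (1 - ρ j)) (hold : ∀ i, i < j → b (j + 1) i = b j i / (1 - ρ j))
    (hρ0 : 0 ≤ ρ j) (hρ1 : ρ j < 1) (hb : ∀ i, i < j → 0 ≤ b j i) : ∀ i, i < j + 1 → 0 ≤ b (j + 1) i := by
  intro i hi
  rcases Nat.lt_succ_iff_lt_or_eq.mp hi with h | h
  · rw [hold i h]; exact div_nonneg (hb i h) (sub_pos.mpr hρ1).le
  · subst h; rw [hnew]; exact div_nonneg hρ0 (sub_pos.mpr hρ1).le

/-! ## §3 One bordering step of the level-coupled system: exact levels and exact responses of the enlarged system -/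

variable {j : ℕ} {k : ℕ → ℕ} {x : ℕ → ℝ} {G : ℕ → ℕ → ℝ}

/-- The level-coupled array is non-negative: `G_{il} = 2x_l S(k_l,k_i)∕k_l ≥ 0` for loads `x_l ≥ 0`. [folklore] -/
theorem lc_array_nonneg {n : ℕ}
    (hG : ∀ i l, G i l = 2 * x l * (∑ t ∈ range (k i), Real.sqrt ((k l : ℝ) / ((k l : ℝ) + t + 1))) / (k l : ℝ))
    (hx : ∀ l, l < n → 0 ≤ x l) : ∀ i l, i < n → l < n → 0 ≤ G i l := by
  intro i l _ hl
  rw [hG]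
  have := hx l hl
  positivity

/-- **EXACT LEVELS OF THE ENLARGED SYSTEM.**  Stage `j` (ages `k_0 > … > k_{j−1}` processed, array `G` on `range j`): exact positive levels `a`,
the non-negative exact response `cj` to the reads `S(k_j,k_i)∕k_j` of the next age `k_j`, and a positive Schur pivot `D = 1 − G_{jj} − 2x_j Σ_l G_{jl}cj_l`;
then ((E78b) `bordered_levels`) the enlarged system on `range (j+1)` has exact positive levels. [folklore] -/
theorem exact_levels_succ {a cj : ℕ → ℝ} {D : ℝ}
    (hG : ∀ i l, G i l = 2 * x l * (∑ t ∈ range (k i), Real.sqrt ((k l : ℝ) / ((k l : ℝ) + t + 1))) / (k l : ℝ))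
    (hx : ∀ l, l < j + 1 → 0 ≤ x l)
    (ha0 : ∀ i, i < j → 0 < a i) (ha : ∀ i, i < j → a i = 1 + ∑ l ∈ range j, G i l * a l)
    (hcj : ∀ i, i < j → cj i = (∑ t ∈ range (k i), Real.sqrt ((k j : ℝ) / ((k j : ℝ) + t + 1))) / (k j : ℝ) + ∑ l ∈ range j, G i l * cj l)
    (hcj0 : ∀ i, i < j → 0 ≤ cj i)
    (hD : D = 1 - G j j - 2 * x j * ∑ l ∈ range j, G j l * cj l) (hD0 : 0 < D) :
    ∃ a' : ℕ → ℝ, (∀ i, i < j + 1 → 0 < a' i) ∧ (∀ i, i < j + 1 → a' i = 1 + ∑ l ∈ range (j + 1), G i l * a' l) := by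
  set ay' : ℝ := (1 + ∑ l ∈ range j, G j l * a l) / D with hay'
  have hxj : 0 ≤ x j := hx j (Nat.lt_succ_self j)
  refine ⟨fun i => if i < j then a i + 2 * x j * ay' * cj i else ay', ?_, ?_⟩
  · have hGnn : ∀ l, l < j → 0 ≤ G j l := fun l hl =>
      lc_array_nonneg (n := j + 1) hG hx j l (Nat.lt_succ_self j) (Nat.lt_succ_of_lt hl)
    have hA : 0 < 1 + ∑ l ∈ range j, G j l * a l := by
      have : 0 ≤ ∑ l ∈ range j, G j l * a l :=
        sum_nonneg fun l hl => mul_nonneg (hGnn l (mem_range.mp hl)) (ha0 l (mem_range.mp hl)).le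
      linarith
    have hay0 : 0 < ay' := div_pos hA hD0
    intro i hi
    by_cases hij : i < j
    · simp only [hij, if_true]
      have := ha0 i hij; have := hcj0 i hij
      positivity
    · simp only [hij, if_false]; exact hay0
  · have hb := bordered_levels (n := j) (G := G) (a := a) (c := cj)
      (φ := fun i => (∑ t ∈ range (k i), Real.sqrt ((k j : ℝ) / ((k j : ℝ) + t + 1))) / (k j : ℝ))
      (e := fun l => G j l) (g := G j j) (xy2 := 2 * x j) (D := D)
      (a' := fun i => if i < j then a i + 2 * x j * ay' * cj i else ay') (ay' := ay')
      hcj ha (by rw [hD]) hD0.ne' hay' (fun i hi => by simp only [hi, if_true])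
    intro i hi
    beta_reduce
    rcases Nat.lt_succ_iff_lt_or_eq.mp hi with hij | hij
    · rw [sum_range_succ, hb.1 i hij]
      simp only [lt_irrefl, if_false]
      rw [hG i j]; ring
    · subst hij
      rw [sum_range_succ]
      simp only [lt_irrefl, if_false]
      linarith [hb.2]

/-- **EXACT RESPONSES OF THE ENLARGED SYSTEM, AND THE RANK-ONE UPDATE OF EVERY ROW FUNCTIONAL.**  Same stage; `cm` the exact non-negative response of
the `j`-system to the reads `S(K,k_i)∕K` of an arbitrary observer scale `K`.  Then ((E78b) `bordered_response`) the enlarged system has an exact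
non-negative response `c'` to the reads of `K` (the new row reads `S(K,k_j)∕K`), and for every row functional `f` ((E78b) `functional_bordered`)
`Σ_{l<j+1} f_l c'_l = Σ_{l<j} f_l cm_l + (2x_j Σ_{l<j} f_l cj_l + f_j)(S(K,k_j)∕K + Σ_{l<j} G_{jl} cm_l)∕D`. [folklore] -/
theorem response_succ {cm cj : ℕ → ℝ} {D : ℝ} (K : ℕ)
    (hG : ∀ i l, G i l = 2 * x l * (∑ t ∈ range (k i), Real.sqrt ((k l : ℝ) / ((k l : ℝ) + t + 1))) / (k l : ℝ))
    (hx : ∀ l, l < j + 1 → 0 ≤ x l)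
    (hcj : ∀ i, i < j → cj i = (∑ t ∈ range (k i), Real.sqrt ((k j : ℝ) / ((k j : ℝ) + t + 1))) / (k j : ℝ) + ∑ l ∈ range j, G i l * cj l)
    (hcj0 : ∀ i, i < j → 0 ≤ cj i)
    (hcm : ∀ i, i < j → cm i = (∑ t ∈ range (k i), Real.sqrt ((K : ℝ) / ((K : ℝ) + t + 1))) / (K : ℝ) + ∑ l ∈ range j, G i l * cm l)
    (hcm0 : ∀ i, i < j → 0 ≤ cm i)
    (hD : D = 1 - G j j - 2 * x j * ∑ l ∈ range j, G j l * cj l) (hD0 : 0 < D) :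
    ∃ c' : ℕ → ℝ, (∀ i, i < j + 1 → 0 ≤ c' i) ∧
      (∀ i, i < j + 1 → c' i = (∑ t ∈ range (k i), Real.sqrt ((K : ℝ) / ((K : ℝ) + t + 1))) / (K : ℝ) + ∑ l ∈ range (j + 1), G i l * c' l) ∧
      (∀ f : ℕ → ℝ, ∑ l ∈ range (j + 1), f l * c' l = ∑ l ∈ range j, f l * cm l +
        (2 * x j * (∑ l ∈ range j, f l * cj l) + f j) * ((∑ t ∈ range (k j), Real.sqrt ((K : ℝ) / ((K : ℝ) + t + 1))) / (K : ℝ) + ∑ l ∈ range j, G j l * cm l) / D) := by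
  set cy' : ℝ := ((∑ t ∈ range (k j), Real.sqrt ((K : ℝ) / ((K : ℝ) + t + 1))) / (K : ℝ) + ∑ l ∈ range j, G j l * cm l) / D with hcy'
  have hxj : 0 ≤ x j := hx j (Nat.lt_succ_self j)
  have hGnn : ∀ l, l < j → 0 ≤ G j l := fun l hl =>
    lc_array_nonneg (n := j + 1) hG hx j l (Nat.lt_succ_self j) (Nat.lt_succ_of_lt hl)
  have hcy0 : 0 ≤ cy' := by
    have h1 : 0 ≤ ∑ l ∈ range j, G j l * cm l :=
      sum_nonneg fun l hl => mul_nonneg (hGnn l (mem_range.mp hl)) (hcm0 l (mem_range.mp hl))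
    have h2 : 0 ≤ (∑ t ∈ range (k j), Real.sqrt ((K : ℝ) / ((K : ℝ) + t + 1))) / (K : ℝ) := by positivity
    exact div_nonneg (by linarith) hD0.le
  refine ⟨fun i => if i < j then cm i + 2 * x j * cy' * cj i else cy', ?_, ?_, ?_⟩
  · intro i hi
    by_cases hij : i < j
    · simp only [hij, if_true]
      have := hcm0 i hij; have := hcj0 i hij
      positivity
    · simp only [hij, if_false]; exact hcy0
  · have hb := bordered_response (n := j) (G := G) (c := cj) (u := cm)
      (w := fun i => (∑ t ∈ range (k i), Real.sqrt ((K : ℝ) / ((K : ℝ) + t + 1))) / (K : ℝ))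
      (φ := fun i => (∑ t ∈ range (k i), Real.sqrt ((k j : ℝ) / ((k j : ℝ) + t + 1))) / (k j : ℝ))
      (e := fun l => G j l) (g := G j j) (xy2 := 2 * x j) (wy := (∑ t ∈ range (k j), Real.sqrt ((K : ℝ) / ((K : ℝ) + t + 1))) / (K : ℝ)) (D := D)
      (u' := fun i => if i < j then cm i + 2 * x j * cy' * cj i else cy') (uy' := cy')
      hcj hcm (by rw [hD]) hD0.ne' hcy' (fun i hi => by simp only [hi, if_true])
    intro i hi
    beta_reduce
    rcases Nat.lt_succ_iff_lt_or_eq.mp hi with hij | hij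
    · rw [sum_range_succ, hb.1 i hij]
      simp only [lt_irrefl, if_false]
      rw [hG i j]; ring
    · subst hij
      rw [sum_range_succ]
      simp only [lt_irrefl, if_false]
      linarith [hb.2]
  · intro f
    have hfb := functional_bordered (n := j) (c := cj) (u := cm) (e := fun l => G j l) (f := f) (xy2 := 2 * x j)
      (wy := (∑ t ∈ range (k j), Real.sqrt ((K : ℝ) / ((K : ℝ) + t + 1))) / (K : ℝ)) (fy := f j) (D := D)
      (u' := fun i => if i < j then cm i + 2 * x j * cy' * cj i else cy') (uy' := cy')
      hD0.ne' hcy' (fun i hi => by simp only [hi, if_true])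
    rw [sum_range_succ]
    beta_reduce
    simp only [lt_irrefl, if_false]
    have hsum : ∑ l ∈ range j, f l * (if l < j then cm l + 2 * x j * cy' * cj l else cy') =
        ∑ l ∈ range j, f l * (fun i => if i < j then cm i + 2 * x j * cy' * cj i else cy') l := rfl
    rw [hsum, hfb]

end Summit.QuantumFields.BalabanUV.Beta.EriceRemainderEnclosureHistoryAutonomyComparisonAgeCompositionStaticChainStageStep

end
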